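import Summits.QuantumFields.YangMills.Theorems.BalabanUVNodesN15KingModelBoxForm
import Summits.QuantumFields.YangMills.Theorems.BalabanUVNodesN15KingModelBoxTransport
import HarnessLib

/-!
# BalabanUVNodes ∕ N15 — THE KING-MODEL RUNG (PART Ν-f, v1.1 doc-only erratum): THE FOLDING `fold(A)(s,t) = Σ_S A(s, σ_S t)` IS AN ALGEBRA HOMOMORPHISM ON THE
# REFLECTION-SYMMETRIC TORUS OPERATORS — `fold(AB) = fold(A)fold(B)`, `fold(1) = 1`, `fold(A)⁻¹ = fold(A⁻¹)` — WITH `c(−Δ_free)+m² = fold(c(−Δ)+m²)`,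
# `G^{Ω} = fold(B⁻¹)`, AND THE TRANSPORT OF EVERY TORUS KERNEL BOUND THROUGH THE FOLDING
# (Track A, DAG node N15 = NE2; FAN-OUT v1.1 §N15 s3 «KING-MODEL RUNG» — «torus-vs-box twin»; count-neutral)

HONEST FRAMING.  Count-neutral (cell `pub-ymgap`, seat `pub-ymgap-dag-n15-e` g39; `--supports stmt-QuantumFields-27366 --as helper` = K3⁸).
TEMPLATE LITERATURE: C. King, Commun. Math. Phys. **102** (1986) 649–677 [King1986] §4 p.670 (l.8–13), citing [Ba 4] = T. Bałaban, Commun. Math. Phys. **89**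
(1983) 571–597 [Balaban1983RegularityDecay] (2.42) p.584: the Ω-propagators are multiple-reflection (image) sums of the operator with free boundary conditions,
so estimates need only be proved for that one operator.  The METHOD behind (2.42): an operator commuting with the reflections, restricted to reflection-symmetric
functions, is an operator on Ω, and inverting commutes with the restriction.  Parts Ν-a…Ν-e did this for ONE operator, King's `B = c(−Δ)+m²`.  THIS FILE states
that method in general, in its doubled-torus form: (§1) for a torus operator `A` on the doubled torus `Π_μ ℤ∕2n_μ`, the FOLDED operator on the box is
`fold(A)(s,t) := Σ_{S⊆{0,…,d}} A(dblBox s, σ_S dblBox t)` — the matrix of `f ↦ (A(f∘foldBox))∘dblBox` (`foldOp_mulVec`: the operator restricted to reflection-symmetric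
functions) — and on REFLECTION-SYMMETRIC operators (`A(σ_S x, σ_S y) = A(x,y)`; e.g. King's `B`, `B⁻¹`, and every product ∕ inverse of such) folding is an
ALGEBRA HOMOMORPHISM:
★★★ **`foldOp_mul`** (`fold(AB) = fold(A)·fold(B)` — the intermediate point runs over the tiling of part Ν-b, and `S ↦ T△S` re-indexes the images),
`foldOp_one`, `foldOp_add`, `foldOp_smul`, `foldOp_transpose`, hence ★★★ **`foldOp_inv`** (`fold(A)⁻¹ = fold(A⁻¹)`: the box inverse of any folded operator is
the IMAGE SUM of the torus inverse); (§2) King's objects ARE folds: ★★ `boxOp_eq_foldOp` (`c(−Δ_free)+m² = fold(B)`, the reflection principle), `G^{Ω} = fold(B⁻¹)`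
(`rfl`), so part Ν-a′'s representation is ONE LINE (`boxOp_inv_eq_foldOp`), and sandwiches ∕ powers fold termwise (`foldOp_sandwich`: `fold(B⁻¹AB⁻¹) =
G^{Ω}·fold(A)·G^{Ω}`; `fold(B^{±k}) = (c(−Δ_free)+m²)^{±k}`); (§3) the transfer of estimates for ANY kernel: ★★★ **`abs_foldOp_le_of_coordProfile`** (a torus bound
antitone in the coordinate distances holds for the folded kernel at the box displacement, `× 2^{d+1}`), ★★ `abs_foldOp_le_exp_of_torusDecay` (King's
`C·e^{−δ·dist}` shape, same `δ`), ★★ `abs_foldOp_sub_direct_le_of_bulk` (in the bulk the folded kernel IS the torus kernel up to `(2^{d+1}−1)C e^{−δ(2r+1)}`).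
So every reflection-symmetric kernel of King's `A = 0` calculus on the torus — `A₀⁻¹`, `G^η_k = N^dA₀⁻¹`, `C^η`, the top piece `C^η − G^η_K`, their
derivatives in `m²` (`B⁻²`), their products — has a box twin with the same algebra and the same bounds; which of them the tree instantiates next is
bookkeeping on periods (`King1986.TorusCongr`), not done here.
NOT Bałaban's covariant `G(Ω)` with a background field; NOT a node discharge (N15 is booked through n15-a's knit, untouched); no torus estimate is
proved here (displayed hypotheses); nothing continuum-YM ∕ `ℝ⁴` ∕ OS axioms ∕ Clay.  0 `sorry`.

ATTRIBUTION ∕ ERRATUM (v1.1, doc-only; ref-I READ-925 LOCATED-1 (quote), adopted).  King's p.670 text (§4, l.8–13) is: «By using multiple reflection representations,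
the propagators G^η_k and G^η_k(Ω) can be written in terms of the operator defined by (2.13) with free boundary conditions (and A = 0, of course), as long
as Ω is a rectangular parallelepiped which is a union of blocks of L^k sites. Such representations are given explicitly in [Ba 4], so it is sufficient to
prove Propositions 3.8 and 3.9 for the operator with free boundary conditions» — i.e. King, following [Ba 4] = [Balaban1983RegularityDecay] (2.42) p.584
(«We represent G_j(□) with the help of the propagator G_j with free boundary conditions on ξZ^d using the multiple reflection method»), writes the
Ω-propagators as image sums of the operator on the INFINITE lattice and proves his estimates for that operator.  Two sentences typeset as King quotations
in v1.0 of parts Ν-c ∕ Ν-d ∕ Ν-f — «…prove estimates on a lattice with periodic boundary conditions, and then carry over the results to Ω» and «All the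
operators we use on Ω can be defined in this way, by restricting the corresponding operators on the torus to symmetric functions» — are NOT in
[King1986]: they were this author's paraphrases of the method, wrongly set in guillemets, and are WITHDRAWN as quotations (likewise v1.0's phrase «every
estimate is proved on the torus and transported to Ω» in parts Ν-a∕a′∕b: King proves the estimates for the free-boundary operator on ηℤ^d; the torus is
this lineage's model of it).  What PART Ν formalises is the PERIODIZED, FINITE form of [Ba 4]'s image series — the `2^{d+1}` images in the TORUS of doubled
periods ([Ba 4]'s image group `Bool^{d+1} × ℤ^{d+1}` modulo the period lattice) — a device of these files (the classical method of images), chosen because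
the tree carries King's operators on tori (`King1986.Torus.lapF`, `effLaplacian`); the box boundary condition so represented is the Neumann («free»)
condition of [Ba 4]'s `G_j(□)` ∕ [Balaban1984PropagatorsII] (2.37).  Every theorem of v1.0 is unchanged; only prose and locators are corrected.

PRIOR TREE ART as named in part Ν-a (AllWindowsColdBox's
signed image sum for one massless kernel; dag-n15-a's `Sym∘G∘χ°` and its `R_T ∘ G = G ∘ R_T` for Bałaban's vector `Δ_a` — the commutation that makes
`G` «reflection symmetric» in the present sense); and — the nearest — cell pub-balaban's `Literature.…Balaban1983to89.B4Reflection242` (dag-lead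
WORDS 481 note): the kernel-checked IMAGES ENGINE for [Ba 4] = [Balaban1983RegularityDecay] (2.42), the INFINITE-LATTICE representation King cites on
p.670 («given explicitly in [Ba 4]»): folding `ℤ^{d+1} → □`, image group `Bool^{d+1} × ℤ^{d+1}` (infinitely many images, `tsum` over fibres, summability
from decay), `ImageSystem.foldOp` (a folded row-finite operator) with `foldOp_mul_imK` («folded `D` × image kernel of `K` = 1»), Neumann folding of the
Laplacian `foldOp_lapK` and of the block term `foldOp_avgK`.  The present file is the finite DOUBLED-TORUS (periodized) form of that series (the `2^{d+1}`
images of a TORUS kernel; finite sums, no summability issue) — NOT the form printed by King ∕ [Ba 4], but equivalent to it by periodization — for the `Tor`-carried objects of this lineage, and adds the statement that folding is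
MULTIPLICATIVE on reflection-symmetric operators (so inverses, products and powers fold termwise); no bridge lemma to `ImageSystem` is attempted
(different carriers: `Fin (d+1) → ℤ` with an infinite image group vs `Tor (dblPer n)` with the group `𝒫({0,…,d})`).

OBJECTS (data).  `foldOp n A : Matrix (KingBox n) (KingBox n) ℝ`; the predicate `IsReflSymm n A` (`∀ S x y, A(σ_S x, σ_S y) = A(x,y)`).

WHAT THIS FILE PROVES (kernel).  §1 `isReflSymm_of_torRefl`, `isReflSymm_lapF`, `isReflSymm_lapF_inv`, `IsReflSymm.inv`, `IsReflSymm.mul`, ★ `foldOp_mulVec`,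
`foldOp_one`, `foldOp_add`, `foldOp_smul`, ★★★ **`foldOp_mul`**, ★★★ **`foldOp_inv`**, `isUnit_foldOp`, `foldOp_transpose`.  §2 ★★ `boxOp_eq_foldOp`, `kingBoxGreen_eq_foldOp`,
★ `boxOp_inv_eq_foldOp`, ★ `foldOp_sandwich`, `foldOp_lapF_pow`, `foldOp_lapF_inv_pow`.  §3 ★★★ **`abs_foldOp_le_of_coordProfile`**, ★★ `abs_foldOp_le_exp_of_torusDecay`,
★★ `abs_foldOp_sub_direct_le_of_bulk`.

HONEST SCOPE.  Any `d`, any sides `n_μ ≥ 1`; real matrices; reflection symmetry is the displayed hypothesis of the homomorphism (it fails for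
non-symmetric `B`: the folded product then picks up cross-image terms).  King's `A = 0` scalar setting; N15 untouched; counts unmoved.  Locators: [King1986]
§4 p.670, (2.13) p.653, (2.17) p.653, Prop. 3.7 (3.60) p.663.
-/

noncomputable section

open scoped BigOperators symmDiff
open Finset Matrix

namespace Summit.QuantumFields.YangMills.BalabanUVNodes.N15KingModelRung.TorusSpectral

open Literature.MathematicalPhysics.QuantumFieldTheory.Balaban1983to89.B5Prop11Plancherel (Tor unitVec)
open Literature.MathematicalPhysics.QuantumFieldTheory.King1986.Torus
open Literature.Probability.LatticeModels (inv_apply_equiv_of_invariant)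
open Summit.QuantumFields.YangMills.BalabanUVNodes.N15.TwoGrid (torRefl torRefl_torRefl torRefl_apply_same torRefl_apply_ne)
open Summit.QuantumFields.YangMills.BalabanUVNodes.N15.KingModel.SrcDiv (lapF_torRefl)
open Summit.QuantumFields.YangMills.BalabanUVNodes.N15KingModelRung.ProperTime (isUnit_lapF)

variable {d : ℕ}

/-! ## §1 Folding a torus operator onto the box: `fold(A)(s,t) = Σ_S A(dblBox s, σ_S dblBox t)` -/

section Fold

variable (n : Fin (d + 1) → ℕ) [hn : ∀ μ, NeZero (n μ)]

/-- THE FOLDING OF A TORUS OPERATOR ONTO THE BOX: `fold(A)(s,t) := Σ_{S ⊆ {0,…,d}} A(dblBox s, σ_S(dblBox t))` — the matrix of `f ↦ (A(f∘foldBox))∘dblBox`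
(the operator restricted to reflection-symmetric functions; the doubled-torus form of the multiple reflection method [Ba 4] (2.42) invoked by King p.670).
[cite: King1986, §4 p.670; Balaban1983RegularityDecay, (2.42) p.584] -/
def foldOp (A : Matrix (Tor (dblPer n)) (Tor (dblPer n)) ℝ) : Matrix (KingBox n) (KingBox n) ℝ :=
  fun s t => ∑ S : Finset (Fin (d + 1)), A (dblBox n s) (torReflS (dblPer n) S (dblBox n t))

/-- A torus operator is REFLECTION SYMMETRIC if it is invariant under every multi-reflection `σ_S` (equivalently under every block-face reflection `σ_κ`).
[cite: King1986, §4 p.670] -/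
def IsReflSymm (A : Matrix (Tor (dblPer n)) (Tor (dblPer n)) ℝ) : Prop :=
  ∀ (S : Finset (Fin (d + 1))) (x y : Tor (dblPer n)), A (torReflS (dblPer n) S x) (torReflS (dblPer n) S y) = A x y

omit hn in
/-- Invariance under the single reflections `σ_κ` suffices. [folklore] -/
theorem isReflSymm_of_torRefl {A : Matrix (Tor (dblPer n)) (Tor (dblPer n)) ℝ}
    (h : ∀ (κ : Fin (d + 1)) (x y : Tor (dblPer n)), A (torRefl (dblPer n) κ x) (torRefl (dblPer n) κ y) = A x y) : IsReflSymm n A := by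
  intro S
  induction S using Finset.induction_on with
  | empty => intro x y; rw [torReflS_empty, torReflS_empty]
  | insert κ S hκ ih => intro x y; rw [torReflS_insert (dblPer n) hκ, torReflS_insert (dblPer n) hκ, h, ih]

omit hn in
/-- King's `B = c(−Δ)+m²` is reflection symmetric. [cite: King1986, (2.13) p.653, §4 p.670] -/
theorem isReflSymm_lapF (c m2 : ℝ) : IsReflSymm n (lapF (dblPer n) c m2) :=
  isReflSymm_of_torRefl n fun κ x y => lapF_torRefl κ c m2 x y

/-- `B⁻¹` is reflection symmetric. [cite: King1986, (2.17) p.653] -/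
theorem isReflSymm_lapF_inv (c m2 : ℝ) : IsReflSymm n (lapF (dblPer n) c m2)⁻¹ :=
  fun S x y => lapF_inv_torReflS (dblPer n) c m2 S x y

/-- The inverse of a reflection-symmetric matrix is reflection symmetric. [folklore] -/
theorem IsReflSymm.inv {A : Matrix (Tor (dblPer n)) (Tor (dblPer n)) ℝ} (hA : IsReflSymm n A) : IsReflSymm n A⁻¹ := by
  intro S x y
  exact inv_apply_equiv_of_invariant (Function.Involutive.toPerm (torReflS (dblPer n) S) (torReflS_torReflS (dblPer n) S)) (fun x' y' => hA S x' y') x y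

/-- Products of reflection-symmetric matrices are reflection symmetric. [folklore] -/
theorem IsReflSymm.mul {A B : Matrix (Tor (dblPer n)) (Tor (dblPer n)) ℝ} (hA : IsReflSymm n A) (hB : IsReflSymm n B) : IsReflSymm n (A * B) := by
  intro S x y
  simp only [Matrix.mul_apply]
  calc ∑ w, A (torReflS (dblPer n) S x) w * B w (torReflS (dblPer n) S y)
      = ∑ w, A (torReflS (dblPer n) S x) (torReflS (dblPer n) S w) * B (torReflS (dblPer n) S w) (torReflS (dblPer n) S y) :=
        (Equiv.sum_comp (Function.Involutive.toPerm (torReflS (dblPer n) S) (torReflS_torReflS (dblPer n) S)) _).symm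
    _ = ∑ w, A x w * B w y := Finset.sum_congr rfl fun w _ => by rw [hA, hB]

/-- ★ `fold(A)` is the matrix of `f ↦ (A(f∘foldBox))∘dblBox`: `(fold(A)f)(s) = (A(f∘foldBox))(dblBox s)`. [cite: King1986, §4 p.670] -/
theorem foldOp_mulVec (A : Matrix (Tor (dblPer n)) (Tor (dblPer n)) ℝ) (f : KingBox n → ℝ) (s : KingBox n) :
    (foldOp n A *ᵥ f) s = (A *ᵥ fun w => f (foldBox n w)) (dblBox n s) := by
  simp only [Matrix.mulVec, dotProduct, foldOp]
  rw [sum_dblTorus_eq_sum_images n (fun w => A (dblBox n s) w * f (foldBox n w)), Finset.sum_comm]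
  simp_rw [foldBox_torReflS_dblBox, Finset.sum_mul]

/-- `fold(1) = 1` (a box point is the image of a box point only trivially). [folklore] -/
theorem foldOp_one : foldOp n (1 : Matrix (Tor (dblPer n)) (Tor (dblPer n)) ℝ) = 1 := by
  ext s t
  simp only [foldOp, Matrix.one_apply]
  rw [Finset.sum_eq_single (∅ : Finset (Fin (d + 1)))]
  · rw [torReflS_empty]
    by_cases hst : s = t
    · subst hst; simp
    · rw [if_neg hst, if_neg (fun h => hst (dblBox_injective n h))]
  · intro S _ hS
    rw [if_neg (dblBox_ne_torReflS n (Finset.nonempty_iff_ne_empty.mpr hS) s t)]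
  · intro h; exact absurd (Finset.mem_univ _) h

omit hn in
/-- `fold` is additive. [folklore] -/
theorem foldOp_add (A B : Matrix (Tor (dblPer n)) (Tor (dblPer n)) ℝ) : foldOp n (A + B) = foldOp n A + foldOp n B := by
  ext s t; simp [foldOp, Finset.sum_add_distrib]

omit hn in
/-- `fold` is homogeneous. [folklore] -/
theorem foldOp_smul (r : ℝ) (A : Matrix (Tor (dblPer n)) (Tor (dblPer n)) ℝ) : foldOp n (r • A) = r • foldOp n A := by
  ext s t; simp [foldOp, Finset.mul_sum]

/-- ★★★ **FOLDING IS MULTIPLICATIVE**: `fold(A·B) = fold(A)·fold(B)` whenever `B` is reflection symmetric — restriction to reflection-symmetric functions is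
an algebra homomorphism on the reflection-symmetric torus operators (the intermediate torus point `w = σ_T(dblBox u)` runs over the tiling;
`B(σ_T u′, σ_S t′) = B(u′, σ_{T△S} t′)` and `S ↦ T △ S` is a bijection). [cite: King1986, §4 p.670; Balaban1983RegularityDecay, (2.42) p.584] -/
theorem foldOp_mul (A B : Matrix (Tor (dblPer n)) (Tor (dblPer n)) ℝ) (hB : IsReflSymm n B) : foldOp n (A * B) = foldOp n A * foldOp n B := by
  ext s t
  simp only [foldOp, Matrix.mul_apply]
  -- LHS: `Σ_S Σ_w A(dbl s, w) B(w, σ_S dbl t)`; tile `w = σ_T dbl u`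
  have hL : ∀ S : Finset (Fin (d + 1)), ∑ w, A (dblBox n s) w * B w (torReflS (dblPer n) S (dblBox n t))
      = ∑ T : Finset (Fin (d + 1)), ∑ u : KingBox n, A (dblBox n s) (torReflS (dblPer n) T (dblBox n u))
          * B (dblBox n u) (torReflS (dblPer n) (T ∆ S) (dblBox n t)) := by
    intro S
    rw [sum_dblTorus_eq_sum_images]
    refine Finset.sum_congr rfl fun T _ => Finset.sum_congr rfl fun u _ => ?_
    congr 1
    rw [← hB T (dblBox n u) (torReflS (dblPer n) (T ∆ S) (dblBox n t)), torReflS_torReflS_eq_symmDiff,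
      symmDiff_symmDiff_cancel_left T S]
  simp_rw [hL, Finset.sum_mul_sum]
  -- LHS `Σ_S Σ_T Σ_u`, RHS `Σ_u Σ_T Σ_S`: bring both to `Σ_T Σ_u Σ_S` and reindex `S ↦ T △ S`
  conv_lhs => rw [Finset.sum_comm]
  conv_rhs => rw [Finset.sum_comm]
  refine Finset.sum_congr rfl fun T _ => ?_
  rw [Finset.sum_comm]
  refine Finset.sum_congr rfl fun u _ => ?_
  exact Equiv.sum_comp (Function.Involutive.toPerm (fun S : Finset (Fin (d + 1)) => T ∆ S) (fun S => symmDiff_symmDiff_cancel_left T S))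
    (fun S => A (dblBox n s) (torReflS (dblPer n) T (dblBox n u)) * B (dblBox n u) (torReflS (dblPer n) S (dblBox n t)))

/-- ★★★ **FOLDING COMMUTES WITH INVERSION**: for a reflection-symmetric invertible torus operator, `fold(A)` is invertible and `fold(A)⁻¹ = fold(A⁻¹)` —
the box inverse of a folded operator is the IMAGE SUM of the torus inverse (the general form of parts Ν-a′ `boxOp_inv_apply`). [cite: King1986, §4 p.670] -/
theorem foldOp_inv {A : Matrix (Tor (dblPer n)) (Tor (dblPer n)) ℝ} (hA : IsReflSymm n A) (hU : IsUnit A) :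
    (foldOp n A)⁻¹ = foldOp n A⁻¹ := by
  have hdet : IsUnit A.det := (Matrix.isUnit_iff_isUnit_det _).mp hU
  have h : foldOp n A * foldOp n A⁻¹ = 1 := by
    rw [← foldOp_mul n A A⁻¹ hA.inv, Matrix.mul_nonsing_inv _ hdet, foldOp_one]
  exact Matrix.inv_eq_right_inv h

/-- `fold(A)` is invertible when `A` is (and reflection symmetric). [folklore] -/
theorem isUnit_foldOp {A : Matrix (Tor (dblPer n)) (Tor (dblPer n)) ℝ} (hA : IsReflSymm n A) (hU : IsUnit A) : IsUnit (foldOp n A) := by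
  have hdet : IsUnit A.det := (Matrix.isUnit_iff_isUnit_det _).mp hU
  refine IsUnit.of_mul_eq_one (foldOp n A⁻¹) ?_
  rw [← foldOp_mul n A A⁻¹ hA.inv, Matrix.mul_nonsing_inv _ hdet, foldOp_one]

omit hn in
/-- `fold(Aᵀ) = fold(A)ᵀ` for reflection-symmetric `A` (each image term is transposed by `σ_S`-invariance). [folklore] -/
theorem foldOp_transpose {A : Matrix (Tor (dblPer n)) (Tor (dblPer n)) ℝ} (hA : IsReflSymm n A) : foldOp n Aᵀ = (foldOp n A)ᵀ := by
  ext s t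
  simp only [foldOp, Matrix.transpose_apply]
  refine Finset.sum_congr rfl fun S _ => ?_
  rw [← hA S (torReflS (dblPer n) S (dblBox n t)) (dblBox n s), torReflS_torReflS]

end Fold

/-! ## §2 King's free-boundary operator and box covariance ARE folds -/

section KingFolds

variable (n : Fin (d + 1) → ℕ) [hn : ∀ μ, NeZero (n μ)]

/-- ★★ **THE FREE-BOUNDARY OPERATOR IS THE FOLD OF THE TORUS OPERATOR**: `c(−Δ_free)+m² = fold(c(−Δ)+m²)` (the reflection principle, parts Ν-a∕Ν-d).
[cite: King1986, §4 p.670, (2.13) p.653] -/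
theorem boxOp_eq_foldOp (c m2 : ℝ) : boxOp n c m2 = foldOp n (lapF (dblPer n) c m2) := by
  rw [Matrix.ext_iff_mulVec]
  intro f
  funext s
  rw [foldOp_mulVec, lapF_mulVec_evenExt_dblBox]

/-- ★★ **THE BOX COVARIANCE IS THE FOLD OF THE TORUS COVARIANCE**: `G^{Ω} = fold(B⁻¹_{T(2n)})` (by definition of the image sum). [cite: King1986, §4 p.670] -/
theorem kingBoxGreen_eq_foldOp (c m2 : ℝ) (s t : KingBox n) : kingBoxGreen n c m2 s t = foldOp n (lapF (dblPer n) c m2)⁻¹ s t := rfl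

/-- ★★★ **KING's MULTIPLE REFLECTION REPRESENTATION AS ONE LINE OF ALGEBRA**: `(c(−Δ_free)+m²)⁻¹ = fold(c(−Δ)+m²)⁻¹ = fold((c(−Δ)+m²)⁻¹) = G^{Ω}` (`c ≥ 0`, `m² > 0`)
— part Ν-a′'s theorem re-derived from the homomorphism. [cite: King1986, §4 p.670] -/
theorem boxOp_inv_eq_foldOp {c m2 : ℝ} (hc : 0 ≤ c) (hm : 0 < m2) : (boxOp n c m2)⁻¹ = foldOp n (lapF (dblPer n) c m2)⁻¹ := by
  rw [boxOp_eq_foldOp, foldOp_inv n (isReflSymm_lapF n c m2) (isUnit_lapF (dblPer n) hc hm)]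

/-- ★★ **FOLDS OF POLYNOMIALS ∕ RESOLVENT WORDS**: e.g. `fold(B⁻¹·A·B⁻¹) = G^{Ω}·fold(A)·G^{Ω}` for every reflection-symmetric `A` — sandwiches of King's torus
kernels fold to the same sandwiches of the box kernels. [cite: King1986, §4 p.670] -/
theorem foldOp_sandwich {c m2 : ℝ} (hc : 0 ≤ c) (hm : 0 < m2) {A : Matrix (Tor (dblPer n)) (Tor (dblPer n)) ℝ} (hA : IsReflSymm n A) :
    foldOp n ((lapF (dblPer n) c m2)⁻¹ * A * (lapF (dblPer n) c m2)⁻¹)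
      = (boxOp n c m2)⁻¹ * foldOp n A * (boxOp n c m2)⁻¹ := by
  rw [foldOp_mul n _ _ (isReflSymm_lapF_inv n c m2), foldOp_mul n _ _ hA, boxOp_inv_eq_foldOp n hc hm]

/-- ★ **POWERS FOLD TO POWERS**: `fold(B^k) = (c(−Δ_free)+m²)^k` and `fold(B^{−k}) = (G^{Ω})^k` — e.g. the box analogue of `B⁻²` (the derivative of the
resolvent in `m²`) is the image sum of the torus `B⁻²`. [cite: King1986, §4 p.670] -/
theorem foldOp_lapF_pow (c m2 : ℝ) (k : ℕ) : foldOp n ((lapF (dblPer n) c m2) ^ k) = (boxOp n c m2) ^ k := by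
  induction k with
  | zero => rw [pow_zero, pow_zero, foldOp_one]
  | succ k ih => rw [pow_succ, pow_succ, foldOp_mul n _ _ (isReflSymm_lapF n c m2), ih, boxOp_eq_foldOp]

/-- `fold(B⁻ᵏ) = (G^{Ω})ᵏ` (`c ≥ 0`, `m² > 0`). [cite: King1986, §4 p.670] -/
theorem foldOp_lapF_inv_pow {c m2 : ℝ} (hc : 0 ≤ c) (hm : 0 < m2) (k : ℕ) :
    foldOp n ((lapF (dblPer n) c m2)⁻¹ ^ k) = ((boxOp n c m2)⁻¹) ^ k := by
  induction k with
  | zero => rw [pow_zero, pow_zero, foldOp_one]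
  | succ k ih => rw [pow_succ, pow_succ, foldOp_mul n _ _ (isReflSymm_lapF_inv n c m2), ih, boxOp_inv_eq_foldOp n hc hm]

end KingFolds


/-! ## §3 Transport of torus bounds through the folding (any reflection-symmetric kernel) -/

section FoldTransport

variable (n : Fin (d + 1) → ℕ) [hn : ∀ μ, NeZero (n μ)]

open Literature.MathematicalPhysics.QuantumFieldTheory.Balaban1983to89.B4TorusKernel.MultiPeriod (circAbs)

/-- ★★★ **EVERY TORUS KERNEL BOUND FOLDS TO THE BOX WITH CONSTANT `× 2^{d+1}`**: if `|A(w,w′)| ≤ Φ((circAbs(w_μ − w′_μ))_μ)` on the doubled torus with `Φ` antitone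
in the vector of coordinate distances, then `|fold(A)(s,t)| ≤ 2^{d+1}·Φ((|s_μ − t_μ|)_μ)` — the transfer «it is sufficient to prove [the estimates] for the
operator with free boundary conditions» (King p.670) for ANY torus kernel (covariances, their differences, sandwiches, powers: whatever is folded).
[cite: King1986, §4 p.670; Balaban1983RegularityDecay, (2.42) p.584] -/
theorem abs_foldOp_le_of_coordProfile (A : Matrix (Tor (dblPer n)) (Tor (dblPer n)) ℝ) (Φ : (Fin (d + 1) → ℤ) → ℝ) (hΦ : Antitone Φ)
    (hA : ∀ w w' : Tor (dblPer n), |A w w'| ≤ Φ (fun μ => circAbs (dblPer n μ) (((w μ).val : ℤ) - ((w' μ).val : ℤ)))) (s t : KingBox n) :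
    |foldOp n A s t| ≤ 2 ^ (d + 1) * Φ (fun μ => |((s μ).val : ℤ) - ((t μ).val : ℤ)|) := by
  unfold foldOp
  refine le_trans (Finset.abs_sum_le_sum_abs _ _) ?_
  have hterm : ∀ S : Finset (Fin (d + 1)),
      |A (dblBox n s) (torReflS (dblPer n) S (dblBox n t))| ≤ Φ (fun μ => |((s μ).val : ℤ) - ((t μ).val : ℤ)|) := by
    intro S
    refine le_trans (hA _ _) (hΦ ?_)
    intro μ
    exact abs_sub_le_circAbs_image n S s t μ
  calc ∑ S : Finset (Fin (d + 1)), |A (dblBox n s) (torReflS (dblPer n) S (dblBox n t))|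
      ≤ ∑ _S : Finset (Fin (d + 1)), Φ (fun μ => |((s μ).val : ℤ) - ((t μ).val : ℤ)|) := Finset.sum_le_sum fun S _ => hterm S
    _ = 2 ^ (d + 1) * Φ (fun μ => |((s μ).val : ℤ) - ((t μ).val : ℤ)|) := by
        rw [Finset.sum_const, Finset.card_univ, Fintype.card_finset, Fintype.card_fin, nsmul_eq_mul]
        push_cast; ring

/-- ★★ **KING's SHAPE, ANY KERNEL**: `|A(w,w′)| ≤ C·e^{−δ·tdistT(w,w′)}` on the doubled torus (`C, δ ≥ 0`) ⟹ `|fold(A)(s,t)| ≤ 2^{d+1}·C·e^{−δ·tdistT(dblBox s, dblBox t)}`.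
[cite: King1986, §4 p.670, Prop. 3.7 (3.60) p.663] -/
theorem abs_foldOp_le_exp_of_torusDecay (A : Matrix (Tor (dblPer n)) (Tor (dblPer n)) ℝ) {C δ : ℝ} (hC : 0 ≤ C) (hδ : 0 ≤ δ)
    (hA : ∀ w w' : Tor (dblPer n), |A w w'| ≤ C * Real.exp (-(δ * tdistT (dblPer n) w w'))) (s t : KingBox n) :
    |foldOp n A s t| ≤ 2 ^ (d + 1) * (C * Real.exp (-(δ * tdistT (dblPer n) (dblBox n s) (dblBox n t)))) := by
  unfold foldOp
  refine le_trans (Finset.abs_sum_le_sum_abs _ _) ?_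
  have hterm : ∀ S : Finset (Fin (d + 1)), |A (dblBox n s) (torReflS (dblPer n) S (dblBox n t))|
      ≤ C * Real.exp (-(δ * tdistT (dblPer n) (dblBox n s) (dblBox n t))) := by
    intro S
    refine le_trans (hA _ _) (mul_le_mul_of_nonneg_left ?_ hC)
    rw [Real.exp_le_exp, neg_le_neg_iff]
    exact mul_le_mul_of_nonneg_left (tdistT_dblBox_le_image n S s t) hδ
  calc ∑ S : Finset (Fin (d + 1)), |A (dblBox n s) (torReflS (dblPer n) S (dblBox n t))|
      ≤ ∑ _S : Finset (Fin (d + 1)), C * Real.exp (-(δ * tdistT (dblPer n) (dblBox n s) (dblBox n t))) := Finset.sum_le_sum fun S _ => hterm S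
    _ = 2 ^ (d + 1) * (C * Real.exp (-(δ * tdistT (dblPer n) (dblBox n s) (dblBox n t)))) := by
        rw [Finset.sum_const, Finset.card_univ, Fintype.card_finset, Fintype.card_fin, nsmul_eq_mul]
        push_cast; ring

/-- ★★ **THE BULK TWIN, ANY KERNEL**: under the same torus bound, for `s, t` at distance `≥ r` from every face the folded kernel equals the direct torus term up
to `(2^{d+1}−1)·C·e^{−δ(2r+1)}`: `|fold(A)(s,t) − A(dblBox s, dblBox t)| ≤ (2^{d+1}−1)·C·e^{−δ(2r+1)}`. [cite: King1986, §4 p.670] -/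
theorem abs_foldOp_sub_direct_le_of_bulk (A : Matrix (Tor (dblPer n)) (Tor (dblPer n)) ℝ) {C δ : ℝ} (hC : 0 ≤ C) (hδ : 0 ≤ δ)
    (hA : ∀ w w' : Tor (dblPer n), |A w w'| ≤ C * Real.exp (-(δ * tdistT (dblPer n) w w'))) (s t : KingBox n) {r : ℕ}
    (hbulk : ∀ μ, r ≤ (s μ).val ∧ r ≤ (t μ).val ∧ (s μ).val + r < n μ ∧ (t μ).val + r < n μ) :
    |foldOp n A s t - A (dblBox n s) (dblBox n t)| ≤ (2 ^ (d + 1) - 1) * (C * Real.exp (-(δ * (2 * r + 1)))) := by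
  unfold foldOp
  rw [← Finset.add_sum_erase _ _ (Finset.mem_univ (∅ : Finset (Fin (d + 1)))), torReflS_empty, add_sub_cancel_left]
  refine le_trans (Finset.abs_sum_le_sum_abs _ _) ?_
  have hterm : ∀ S ∈ Finset.univ.erase (∅ : Finset (Fin (d + 1))),
      |A (dblBox n s) (torReflS (dblPer n) S (dblBox n t))| ≤ C * Real.exp (-(δ * (2 * r + 1))) := by
    intro S hS
    have hne : S.Nonempty := Finset.nonempty_iff_ne_empty.mpr (Finset.ne_of_mem_erase hS)
    refine le_trans (hA _ _) (mul_le_mul_of_nonneg_left ?_ hC)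
    rw [Real.exp_le_exp, neg_le_neg_iff]
    exact mul_le_mul_of_nonneg_left (tdistT_image_ge_of_bulk n hne s t hbulk) hδ
  calc ∑ S ∈ Finset.univ.erase (∅ : Finset (Fin (d + 1))), |A (dblBox n s) (torReflS (dblPer n) S (dblBox n t))|
      ≤ ∑ _S ∈ Finset.univ.erase (∅ : Finset (Fin (d + 1))), C * Real.exp (-(δ * (2 * r + 1))) := Finset.sum_le_sum hterm
    _ = (2 ^ (d + 1) - 1) * (C * Real.exp (-(δ * (2 * r + 1)))) := by
        rw [Finset.sum_const, Finset.card_erase_of_mem (Finset.mem_univ _), Finset.card_univ, Fintype.card_finset, Fintype.card_fin,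
          nsmul_eq_mul]
        have h1 : 1 ≤ 2 ^ (d + 1) := Nat.one_le_two_pow
        push_cast [Nat.cast_sub h1]
        ring

end FoldTransport

end Summit.QuantumFields.YangMills.BalabanUVNodes.N15KingModelRung.TorusSpectral
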